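import Literature.Computability.Complexity.RandomOraclePHSipser
import Literature.Computability.Complexity.SigmaPRelClosure
import Literature.Computability.Complexity.OracleProofs
import Literature.Computability.Complexity.StackBricksArith
import Literature.Computability.Complexity.StackBricksStrings
import Literature.Computability.Complexity.BrickAlgebra
import Literature.Computability.Complexity.StringEquality
import Literature.Computability.Complexity.LengthCompare
import Literature.Computability.Complexity.FPStringBricks
import HarnessLib

/-!
# The Sipser languages of an oracle are in `PH^A` (discharge of `sipserLang_mem_PHRel`)

Sibling proof file of `RandomOraclePHSipser.lean`. It proves the named fact

* `Literature.Computability.Complexity.sipserLang_mem_PHRel_holds : sipserLang_mem_PHRel` —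
  for every depth `d` and every oracle `A`, `sipserLang d A ∈ PH^A`,

the routine half of the `PH`–`AC⁰` connection (Ko 1989, §4.2, p. 15–16, for the diagonal
languages `L_A = {0^{(k+1)n} | (∃y₁, |y₁| = n)(∀y₂, |y₂| = n)⋯(Q_k y_k, |y_k| = n) 0ⁿy₁y₂⋯y_k ∈ A}`:
"Then, clearly, `L_A ∈ Σₖ^P(A)`"; the tree's `sipserLang d A` reads the fan-ins off the input and
places RST's `Sipser_d` on the oracle bits, `RandomOraclePHSipser.lean`).

## The argument and its formalisation

No machine is written: the statement is assembled from the closure properties of `PH^O`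
(`SigmaPRelClosure.lean`: `PH^O` is closed under polynomially bounded string quantifiers
`bexStr`/`ballStr`, under polynomial-time preimages and under `∩`/`∪` with `P` languages, and
contains `P^O`) and from the tree's algebra of `FP` string functions (`fanoutFn`, `comp_mem_FP`,
the bricks `addFn`, `prodFn`, `ltFn`, `subFn`, `padTakeFn`, the projections `fstF`/`sndF`/`nthF`,
the tests `setOf_apply_eq_apply_mem_P`, `LenLe`).

* **State records.** A partial descent into the formula is the record
  `st x rest S W = ⟨x, ⟨rest, ⟨S, W⟩⟩⟩`: the input `x`, the code `rest = listcode vs` of the fan-ins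
  still to be read (`encodingListNatBool.encode ws = ⟨1^{|ws|}, listcode ws⟩`, `encode_eq`), and the
  numerals of the offset `S` and the weight `W` of the current subformula, whose leaf `a` is leaf
  number `S + W · addrIndex vs a` of the whole instance (mixed radix, least significant digit at
  the root). `startF x = st x (listcode ws) 0 1`; one quantifier guesses a numeral `y` and
  `stepF ⟨st x (v :: vs) S W, y⟩ = st x vs (S + W·⟦y⟧) (W·v)` (`stepF_apply`); the guess is in
  range iff `⟦y⟧ < v` (`V`, a `P` language); at the bottom the single oracle query is
  `addrF (st x [] S W) = x ++ takeD |x| (encodeNat S) 0 = sipserAddr x S` (`takeD_encodeNat`), so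
  the matrix `L0 A = addrF ⁻¹' A` is in `P^A` (`A ∈ P^A`, `self_mem_PRel_ofLanguage_holds`, and
  `preimage_mem_PRel`).
* **The quantifier languages** `quantLang A r b` (`r` levels to go, root gate `∧` iff `b`):
  `quantLang A 0 b = L0 A`, `quantLang A (r+1) false = ∃ʸ (V ∩ stepF⁻¹' quantLang A r true)`,
  `quantLang A (r+1) true = ∀ʸ (Vᶜ ∪ stepF⁻¹' quantLang A r false)`, all in `PH^A`
  (`quantLang_mem_PHRel`), and **`mem_quantLang_iff`**: `st x (listcode vs) S W ∈ quantLang A |vs| b`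
  iff `sipserEval vs b (a ↦ [sipserAddr x (S + W · addrIndex vs a) ∈ A])` (induction on `vs`; the
  witness `encodeNat i`, `i < v`, has length `≤ |encodeNat v| ≤ |record|`, so the bound `X` suffices).
* **Well-formed inputs** `WF d ∈ P` (`WF_mem_P`, `mem_WF_iff`): the first component of `x` is a
  pair `⟨1^d, r⟩` with `r` the code of a list of `d` canonical numerals (`ListCode d`, a `P` language
  defined by recursion on `d`) whose product `∏ ws` (`prodF d`, a `d`-fold `prodFn`) satisfies
  `|encodeNat (∏ ws - 1)| ≤ |x|`, i.e. `∏ ws ≤ 2^{|x|}`.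
* **Assembly**: `sipserLang d A = WF d ∩ startF ⁻¹' quantLang A d (bodd d)` (`sipserLang_eq`), hence
  `sipserLang d A ∈ PH^A` (`inter_P_mem_PHRel`, `preimage_mem_PHRel`).

## References

* [Ko1989] K.-I Ko, *Constructing oracles by lower bound techniques for circuits*, in: Combinatorics,
  Computing and Complexity (Kluwer 1989), `lit read doi:10.1007/978-94-009-2411-6_2`, §4.2
  (p. 15 L53–54: the languages `L_A`; p. 16 L1: "Then, clearly, `L_A ∈ Σₖ^P(A)`").
* L. J. Stockmeyer, *The polynomial-time hierarchy*, Theoret. Comput. Sci. 3 (1976), §3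
  (closure of the levels under bounded quantification).
* [RossmanServedioTan2015] arXiv:1504.03398, §2.3 (p. 7) (the connection, as used for Thm. 2).
-/

noncomputable section

namespace Literature.Computability.Complexity

open _root_.Computability Literature.Computability.QuantumComplexity Polynomial Brick

namespace SipserPH

/-! ### Codes of fan-in lists and state records -/

/-- The body of the code of a list of naturals: `listcode [w₁, …, w_d] = ⟨w₁, ⟨w₂, … ⟨w_d, ε⟩…⟩⟩`
(canonical numerals, nested pairs). [cite: AroraBarak2009, §0.1] -/
def listcode (ws : List ℕ) : List Bool :=
  ws.foldr (fun a acc => boolPair (encodeNat a) acc) []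

/-- Code of the empty list. [folklore] -/
@[simp] theorem listcode_nil : listcode [] = [] := rfl

/-- Code of a cons. [folklore] -/
@[simp] theorem listcode_cons (w : ℕ) (ws : List ℕ) :
    listcode (w :: ws) = boolPair (encodeNat w) (listcode ws) := rfl

/-- The tree's encoding of a list of naturals is the unary length paired with `listcode`.
[cite: AroraBarak2009, §0.1] -/
theorem encode_eq (ws : List ℕ) :
    encodingListNatBool.encode ws = boolPair (unaryEncodeNat ws.length) (listcode ws) := rfl

/-- The state record `⟨x, ⟨rest, ⟨S, W⟩⟩⟩` of a partial descent: input, code of the remaining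
fan-ins, offset and weight numerals. [folklore] -/
def st (x rest S W : List Bool) : List Bool := boolPair x (boolPair rest (boolPair S W))

/-- A numeral below the first remaining fan-in is no longer than the record. [folklore] -/
theorem length_encodeNat_le_st (x : List Bool) {v i : ℕ} (hi : i < v) (vs : List ℕ) (S W : List Bool) :
    (encodeNat i).length ≤ (st x (listcode (v :: vs)) S W).length := by
  have h1 : (encodeNat i).length ≤ (encodeNat v).length := by
    rw [TM2Pass.length_encodeNat_eq_size, TM2Pass.length_encodeNat_eq_size]
    exact Nat.size_le_size hi.le
  have h2 : (encodeNat v).length ≤ (st x (listcode (v :: vs)) S W).length := by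
    simp only [st, listcode_cons, length_boolPair]
    omega
  exact h1.trans h2

/-! ### The polynomial-time maps -/

/-- The initial record `startF x = ⟨x, ⟨snd (fst x), ⟨0, 1⟩⟩⟩` (remaining fan-ins = the body of the
code carried by `x`, offset `0`, weight `1`). [folklore] -/
def startF : List Bool → List Bool :=
  fanoutFn id (fanoutFn (sndF ∘ fstF) (fun _ => boolPair (encodeNat 0) (encodeNat 1)))

/-- Value of `startF`. [folklore] -/
theorem startF_apply (x : List Bool) : startF x = st x (sndF (fstF x)) (encodeNat 0) (encodeNat 1) := by
  simp only [startF, fanoutFn_apply, Function.comp_apply, id, st]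

/-- `startF ∈ FP`. [folklore] -/
theorem startF_mem_FP : startF ∈ FP :=
  fanoutFn_mem_FP OracleCompose.id_mem_FP
    (fanoutFn_mem_FP (comp_mem_FP sndF_mem_FP fstF_mem_FP) (const_mem_FP _))

/-- One descent step on `⟨record, guess⟩`: drop the first remaining fan-in `v`, move the offset to
`S + W·⟦y⟧` and the weight to `W·v`. [folklore] -/
def stepF : List Bool → List Bool :=
  fanoutFn (fstF ∘ fstF)
    (fanoutFn (sndF ∘ nthF 1 ∘ fstF)
      (fanoutFn (addFn ∘ fanoutFn (nthF 2 ∘ fstF) (prodFn ∘ fanoutFn (sndPow 2 ∘ fstF) sndF))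
        (prodFn ∘ fanoutFn (sndPow 2 ∘ fstF) (fstF ∘ nthF 1 ∘ fstF))))

/-- Value of `stepF` on a record and a guess. [folklore] -/
theorem stepF_apply (x rest S W y : List Bool) :
    stepF (boolPair (st x rest S W) y) =
      st x (sndF rest) (encodeNat (bitsToNat S + bitsToNat W * bitsToNat y))
        (encodeNat (bitsToNat W * bitsToNat (fstF rest))) := by
  simp [stepF, st]

/-- `stepF ∈ FP`. [folklore] -/
theorem stepF_mem_FP : stepF ∈ FP :=
  fanoutFn_mem_FP (comp_mem_FP fstF_mem_FP fstF_mem_FP)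
    (fanoutFn_mem_FP (comp_mem_FP sndF_mem_FP (comp_mem_FP (nthF_mem_FP 1) fstF_mem_FP))
      (fanoutFn_mem_FP
        (comp_mem_FP addFn_mem_FP (fanoutFn_mem_FP (comp_mem_FP (nthF_mem_FP 2) fstF_mem_FP)
          (comp_mem_FP prodFn_mem_FP (fanoutFn_mem_FP (comp_mem_FP (sndPow_mem_FP 2) fstF_mem_FP)
            sndF_mem_FP))))
        (comp_mem_FP prodFn_mem_FP (fanoutFn_mem_FP (comp_mem_FP (sndPow_mem_FP 2) fstF_mem_FP)
          (comp_mem_FP fstF_mem_FP (comp_mem_FP (nthF_mem_FP 1) fstF_mem_FP))))))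

/-- The oracle query at the bottom: `x` followed by the first `|x|` bits of the offset numeral
(padded with `0`s). [cite: Ko1989, §4.2 (p. 15)] -/
def addrF : List Bool → List Bool :=
  fun u => fstF u ++ (fstF ∘ padTakeFn ∘ fanoutFn fstF (nthF 2)) u

/-- Value of `addrF` on a record. [folklore] -/
theorem addrF_apply (x rest S W : List Bool) :
    addrF (st x rest S W) = x ++ List.takeD x.length S false := by
  simp [addrF, st]

/-- `addrF ∈ FP`. [folklore] -/
theorem addrF_mem_FP : addrF ∈ FP :=
  append_mem_FP fstF_mem_FP (comp_mem_FP fstF_mem_FP (comp_mem_FP padTakeFn_mem_FP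
    (fanoutFn_mem_FP fstF_mem_FP (nthF_mem_FP 2))))

/-! ### Padded numerals are `natBits` -/

/-- Symbol `i` of a bit string is bit `i` of its value. [folklore] -/
theorem getD_eq_testBit_bitsToNat : ∀ (l : List Bool) (i : ℕ), l.getD i false = (bitsToNat l).testBit i
  | [], i => by simp
  | b :: l, 0 => by
    rw [List.getD_cons_zero, bitsToNat_cons, Nat.testBit_zero]
    cases b <;> simp
  | b :: l, i + 1 => by
    rw [List.getD_cons_succ, bitsToNat_cons, Nat.testBit_succ, getD_eq_testBit_bitsToNat l i]
    congr 1
    have hb := Bool.toNat_le b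
    omega

/-- `takeD` is the list of the first `w` symbols read with default `0`. [folklore] -/
theorem takeD_eq_ofFn_getD : ∀ (w : ℕ) (l : List Bool),
    List.takeD w l false = List.ofFn fun j : Fin w => l.getD j false
  | 0, l => by simp
  | w + 1, l => by
    rw [List.takeD_succ, List.ofFn_succ, takeD_eq_ofFn_getD w l.tail]
    cases l <;> simp

/-- **The padded numeral of `n` of width `w` is `natBits w n`.** [folklore] -/
theorem takeD_encodeNat (w n : ℕ) : List.takeD w (encodeNat n) false = natBits w n := by
  rw [takeD_eq_ofFn_getD, natBits]
  congr 1
  funext j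
  rw [getD_eq_testBit_bitsToNat, bitsToNat_encodeNat]

/-! ### Membership in combined languages (definitional unfoldings) -/

/-- Membership in the complement of a language. [folklore] -/
theorem mem_compl' {L : Language Bool} {z : List Bool} : z ∈ Lᶜ ↔ ¬ z ∈ L := Iff.rfl

/-- Membership in a preimage language. [folklore] -/
theorem mem_preimage' {L : Language Bool} {f : List Bool → List Bool} {z : List Bool} :
    @Membership.mem (List Bool) (Language Bool) _ (f ⁻¹' L) z ↔ f z ∈ L := Iff.rfl

/-! ### The languages -/

/-- The range test of a guess: `⟨record, y⟩ ∈ V` iff `⟦y⟧ < ⟦first remaining fan-in⟧`. [folklore] -/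
def V : Language Bool :=
  {z | (ltFn ∘ fanoutFn sndF (fstF ∘ nthF 1 ∘ fstF)) z = (fun _ => [true]) z}

/-- `V ∈ P`. [folklore] -/
theorem V_mem_P : V ∈ Classes.P :=
  setOf_apply_eq_apply_mem_P
    (comp_mem_FP ltFn_mem_FP (fanoutFn_mem_FP sndF_mem_FP
      (comp_mem_FP fstF_mem_FP (comp_mem_FP (nthF_mem_FP 1) fstF_mem_FP))))
    (const_mem_FP [true])

/-- Membership in `V` (definitional). [folklore] -/
theorem mem_V {z : List Bool} :
    z ∈ V ↔ (ltFn ∘ fanoutFn sndF (fstF ∘ nthF 1 ∘ fstF)) z = (fun _ => [true]) z := Iff.rfl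

/-- Membership in `V`. [folklore] -/
theorem mem_V_iff (x rest S W y : List Bool) :
    boolPair (st x rest S W) y ∈ V ↔ bitsToNat y < bitsToNat (fstF rest) := by
  rw [mem_V]
  simp [st]

/-- The matrix: the single oracle query `addrF`. [cite: Ko1989, §4.2 (p. 15)] -/
def L0 (A : Language Bool) : Language Bool := addrF ⁻¹' A

/-- `L0 A ∈ P^A` (`A ∈ P^A` and a polynomial-time preimage). [cite: BakerGillSolovay1975, §1] -/
theorem L0_mem_PRel (A : Language Bool) : L0 A ∈ PRel (Oracle.ofLanguage A) :=
  preimage_mem_PRel (self_mem_PRel_ofLanguage_holds A) addrF_mem_FP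

/-- **The quantifier languages**: `r` alternating polynomially bounded quantifiers (root `∀` iff
`b`), each guess range-checked by `V` and folded into the record by `stepF`, over the matrix `L0 A`.
[cite: Ko1989, §4.2 (p. 15–16)] [cite: Stockmeyer1976, §3] -/
def quantLang (A : Language Bool) : ℕ → Bool → Language Bool
  | 0, _ => L0 A
  | r + 1, false => bexStr X (V ⊓ stepF ⁻¹' quantLang A r true)
  | r + 1, true => ballStr X (Vᶜ ⊔ stepF ⁻¹' quantLang A r false)

/-- No quantifier: the matrix. [folklore] -/
theorem quantLang_zero (A : Language Bool) (b : Bool) : quantLang A 0 b = L0 A := by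
  cases b <;> rfl

/-- An `∨` root: a bounded `∃` over range-checked guesses. [folklore] -/
theorem quantLang_succ_false (A : Language Bool) (r : ℕ) :
    quantLang A (r + 1) false = bexStr X (V ⊓ stepF ⁻¹' quantLang A r true) := rfl

/-- An `∧` root: a bounded `∀` over range-checked guesses. [folklore] -/
theorem quantLang_succ_true (A : Language Bool) (r : ℕ) :
    quantLang A (r + 1) true = ballStr X (Vᶜ ⊔ stepF ⁻¹' quantLang A r false) := rfl

/-- **Every quantifier language is in `PH^A`.** [cite: Ko1989, §4.2 (p. 16)] [cite: Stockmeyer1976, §3] -/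
theorem quantLang_mem_PHRel (A : Language Bool) :
    ∀ (r : ℕ) (b : Bool), quantLang A r b ∈ PHRel (Oracle.ofLanguage A)
  | 0, b => by
    cases b <;> exact PRel_subset_PHRel _ (L0_mem_PRel A)
  | r + 1, false =>
    bexStr_mem_PHRel (inter_P_mem_PHRel V_mem_P
      (preimage_mem_PHRel (quantLang_mem_PHRel A r true) stepF_mem_FP)) X
  | r + 1, true =>
    ballStr_mem_PHRel (union_P_mem_PHRel (compl_mem_P_iff.2 V_mem_P)
      (preimage_mem_PHRel (quantLang_mem_PHRel A r false) stepF_mem_FP)) X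

/-- The oracle bit of leaf number `n` at input `x`, the address written with a padded numeral.
[cite: Ko1989, §4.2 (p. 15)] -/
def leafBit (A : Language Bool) (x : List Bool) (n : ℕ) : Bool :=
  A.boolIndicator (x ++ List.takeD x.length (encodeNat n) false)

/-- The leaf bits with the padded address are the leaf bits of `sipserLang`. [folklore] -/
theorem leafBit_eq (A : Language Bool) (x : List Bool) (n : ℕ) :
    leafBit A x n = A.boolIndicator (sipserAddr x n) := by
  rw [leafBit, takeD_encodeNat]
  rfl

/-- Re-indexing the leaves below child `i`: offset `S + W i`, weight `W v`. [folklore] -/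
theorem leaf_fun_eq (A : Language Bool) (x : List Bool) (v : ℕ) (vs : List ℕ) (S W : ℕ) (i : Fin v) :
    (fun a : Addr vs => leafBit A x (S + W * addrIndex (v :: vs) (i, a))) =
      fun a => leafBit A x ((S + W * i) + (W * v) * addrIndex vs a) := by
  funext a
  show leafBit A x (S + W * ((i : ℕ) + v * addrIndex vs a)) = _
  congr 1
  ring

/-- **Semantics of the quantifier languages**: on the record of input `x`, remaining fan-ins `vs`,
offset `S` and weight `W`, `quantLang A |vs| b` holds iff the alternating formula with fan-ins `vs`
and root `∧` iff `b` is true on the oracle bits of the leaves `S + W · addrIndex vs a`.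
[cite: Ko1989, §4.2 (p. 15–16)] -/
theorem mem_quantLang_iff (A : Language Bool) (x : List Bool) : ∀ (vs : List ℕ) (b : Bool) (S W : ℕ),
    st x (listcode vs) (encodeNat S) (encodeNat W) ∈ quantLang A vs.length b ↔
      sipserEval vs b (fun a => leafBit A x (S + W * addrIndex vs a)) = true
  | [], b, S, W => by
    rw [List.length_nil, quantLang_zero, L0, mem_preimage', addrF_apply, sipserEval_nil]
    simp only [addrIndex, mul_zero, add_zero, leafBit]
    exact Set.mem_iff_boolIndicator _ _
  | v :: vs, false, S, W => by
    have ih := fun S' W' => mem_quantLang_iff A x vs true S' W'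
    have memI : ∀ (L₁ L₂ : Language Bool) (z : List Bool), z ∈ L₁ ⊓ L₂ ↔ z ∈ L₁ ∧ z ∈ L₂ :=
      fun _ _ _ => Iff.rfl
    rw [List.length_cons, quantLang_succ_false]
    simp only [mem_bexStr, eval_X, memI, mem_preimage', mem_V_iff, listcode_cons, fstF_boolPair,
      sndF_boolPair, bitsToNat_encodeNat, stepF_apply, sipserEval_cons_false, ih]
    constructor
    · rintro ⟨y, -, hyV, hyQ⟩
      refine ⟨⟨bitsToNat y, hyV⟩, ?_⟩
      rw [leaf_fun_eq]
      exact hyQ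
    · rintro ⟨i, hi⟩
      refine ⟨encodeNat i, length_encodeNat_le_st x i.isLt vs _ _, ?_⟩
      rw [bitsToNat_encodeNat, ← leaf_fun_eq]
      exact ⟨i.isLt, hi⟩
  | v :: vs, true, S, W => by
    have ih := fun S' W' => mem_quantLang_iff A x vs false S' W'
    have memS : ∀ (L₁ L₂ : Language Bool) (z : List Bool), z ∈ L₁ ⊔ L₂ ↔ z ∈ L₁ ∨ z ∈ L₂ :=
      fun _ _ _ => Iff.rfl
    rw [List.length_cons, quantLang_succ_true]
    simp only [mem_ballStr, eval_X, memS, mem_compl', mem_preimage', mem_V_iff, listcode_cons,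
      fstF_boolPair, sndF_boolPair, bitsToNat_encodeNat, stepF_apply, sipserEval_cons_true, ih]
    constructor
    · intro h i
      have hy := h (encodeNat i) (length_encodeNat_le_st x i.isLt vs _ _)
      rw [bitsToNat_encodeNat, ← leaf_fun_eq] at hy
      exact hy.resolve_left fun h' => h' i.isLt
    · intro h y _
      by_cases hy : bitsToNat y < v
      · right
        rw [← leaf_fun_eq A x v vs S W ⟨bitsToNat y, hy⟩]
        exact h ⟨bitsToNat y, hy⟩
      · exact Or.inl hy

/-! ### Well-formed inputs -/

/-- The product of the first `k` numerals of a list code (`1` for `k = 0`). [folklore] -/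
def prodF : ℕ → (List Bool → List Bool)
  | 0 => fun _ => encodeNat 1
  | k + 1 => prodFn ∘ fanoutFn fstF (prodF k ∘ sndF)

/-- `prodF k ∈ FP`. [folklore] -/
theorem prodF_mem_FP : ∀ k : ℕ, prodF k ∈ FP
  | 0 => const_mem_FP _
  | k + 1 => comp_mem_FP prodFn_mem_FP
      (fanoutFn_mem_FP fstF_mem_FP (comp_mem_FP (prodF_mem_FP k) sndF_mem_FP))

/-- On the code of `ws`, `prodF |ws|` is the numeral of `∏ ws`. [folklore] -/
theorem prodF_listcode : ∀ ws : List ℕ, prodF ws.length (listcode ws) = encodeNat ws.prod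
  | [] => by simp [prodF]
  | w :: ws => by simp [prodF, prodF_listcode ws]

/-- Strings that are pairs (the pair decoder inverts on them). [folklore] -/
def WellPaired : Language Bool := {r | id r = fanoutFn fstF sndF r}

/-- `WellPaired ∈ P`. [folklore] -/
theorem WellPaired_mem_P : WellPaired ∈ Classes.P :=
  setOf_apply_eq_apply_mem_P OracleCompose.id_mem_FP (fanoutFn_mem_FP fstF_mem_FP sndF_mem_FP)

/-- Membership in `WellPaired`. [folklore] -/
theorem mem_WellPaired_iff (r : List Bool) : r ∈ WellPaired ↔ r = boolPair (fstF r) (sndF r) := by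
  show id r = fanoutFn fstF sndF r ↔ _
  rw [fanoutFn_apply]
  rfl

/-- Pairs are well-paired. [folklore] -/
theorem boolPair_mem_WellPaired (a b : List Bool) : boolPair a b ∈ WellPaired := by
  rw [mem_WellPaired_iff, fstF_boolPair, sndF_boolPair]

/-- Strings whose first component is a canonical numeral. [folklore] -/
def CanonHead : Language Bool := {r | fstF r = (addFn ∘ fanoutFn fstF (fun _ => [])) r}

/-- `CanonHead ∈ P`. [folklore] -/
theorem CanonHead_mem_P : CanonHead ∈ Classes.P :=
  setOf_apply_eq_apply_mem_P fstF_mem_FP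
    (comp_mem_FP addFn_mem_FP (fanoutFn_mem_FP fstF_mem_FP (const_mem_FP _)))

/-- Membership in `CanonHead`. [folklore] -/
theorem mem_CanonHead_iff (r : List Bool) : r ∈ CanonHead ↔ fstF r = encodeNat (bitsToNat (fstF r)) := by
  have h : r ∈ CanonHead ↔ fstF r = (addFn ∘ fanoutFn fstF (fun _ => [])) r := Iff.rfl
  rw [h, Function.comp_apply, fanoutFn_apply, addFn_boolPair, bitsToNat_nil, add_zero]

/-- **Codes of lists of `k` naturals**, a `P` language by recursion on `k`: the empty string, resp.
a pair with canonical head whose tail is a code of `k` naturals. [cite: AroraBarak2009, §0.1] -/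
def ListCode : ℕ → Language Bool
  | 0 => {r | id r = (fun _ => ([] : List Bool)) r}
  | k + 1 => (WellPaired ⊓ CanonHead) ⊓ sndF ⁻¹' ListCode k

/-- `ListCode k ∈ P`. [folklore] -/
theorem ListCode_mem_P : ∀ k : ℕ, ListCode k ∈ Classes.P
  | 0 => setOf_apply_eq_apply_mem_P OracleCompose.id_mem_FP (const_mem_FP _)
  | k + 1 => inter_mem_P (inter_mem_P WellPaired_mem_P CanonHead_mem_P)
      (preimage_mem_P (ListCode_mem_P k) sndF_mem_FP)

/-- **`ListCode k` is the set of codes of lists of length `k`.** [folklore] -/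
theorem mem_ListCode_iff : ∀ (k : ℕ) (r : List Bool),
    r ∈ ListCode k ↔ ∃ ws : List ℕ, ws.length = k ∧ r = listcode ws
  | 0, r => by
    have h : r ∈ ListCode 0 ↔ id r = (fun _ => ([] : List Bool)) r := Iff.rfl
    rw [h]
    change r = [] ↔ _
    constructor
    · intro h
      exact ⟨[], rfl, h⟩
    · rintro ⟨ws, hlen, rfl⟩
      rw [List.length_eq_zero_iff] at hlen
      rw [hlen, listcode_nil]
  | k + 1, r => by
    have h : r ∈ ListCode (k + 1) ↔ (r ∈ WellPaired ∧ r ∈ CanonHead) ∧ sndF r ∈ ListCode k := Iff.rfl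
    rw [h, mem_WellPaired_iff, mem_CanonHead_iff, mem_ListCode_iff k]
    constructor
    · rintro ⟨⟨hwp, hcan⟩, ws, hlen, hws⟩
      refine ⟨bitsToNat (fstF r) :: ws, by rw [List.length_cons, hlen], ?_⟩
      rw [listcode_cons, ← hcan, ← hws]
      exact hwp
    · rintro ⟨ws, hlen, rfl⟩
      cases ws with
      | nil => exact absurd hlen (by simp)
      | cons w ws =>
        rw [listcode_cons, fstF_boolPair, sndF_boolPair, bitsToNat_encodeNat]
        exact ⟨⟨rfl, rfl⟩, ws, by simpa using hlen, rfl⟩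

/-- **Well-formed inputs of depth `d`**: the first component of `x` is a pair `⟨1^d, r⟩`, `r` codes a
list `ws` of `d` naturals, and `|encodeNat (∏ ws - 1)| ≤ |x|` (i.e. `∏ ws ≤ 2^{|x|}`). [cite: Ko1989, §4.2 (p. 15)] -/
def WF (d : ℕ) : Language Bool :=
  (({x | fstF x = fanoutFn (fstF ∘ fstF) (sndF ∘ fstF) x} ⊓
      {x | (fstF ∘ fstF) x = (fun _ => unaryEncodeNat d) x}) ⊓
    (sndF ∘ fstF) ⁻¹' ListCode d) ⊓
  (fanoutFn id (subFn ∘ fanoutFn (prodF d ∘ sndF ∘ fstF) (fun _ => [true]))) ⁻¹' LenLe X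

/-- `WF d ∈ P`. [folklore] -/
theorem WF_mem_P (d : ℕ) : WF d ∈ Classes.P :=
  inter_mem_P
    (inter_mem_P
      (inter_mem_P
        (setOf_apply_eq_apply_mem_P fstF_mem_FP (fanoutFn_mem_FP (comp_mem_FP fstF_mem_FP fstF_mem_FP)
          (comp_mem_FP sndF_mem_FP fstF_mem_FP)))
        (setOf_apply_eq_apply_mem_P (comp_mem_FP fstF_mem_FP fstF_mem_FP) (const_mem_FP _)))
      (preimage_mem_P (ListCode_mem_P d) (comp_mem_FP sndF_mem_FP fstF_mem_FP)))
    (preimage_mem_P (LenLe_mem_P X) (fanoutFn_mem_FP OracleCompose.id_mem_FP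
      (comp_mem_FP subFn_mem_FP (fanoutFn_mem_FP
        (comp_mem_FP (prodF_mem_FP d) (comp_mem_FP sndF_mem_FP fstF_mem_FP)) (const_mem_FP _)))))

/-- **Well-formedness is the side condition of `sipserLang`.** [cite: Ko1989, §4.2 (p. 15)] -/
theorem mem_WF_iff (d : ℕ) (x : List Bool) :
    x ∈ WF d ↔ ∃ ws : List ℕ, ws.length = d ∧ (boolUnpair x).1 = encodingListNatBool.encode ws ∧
      ws.prod ≤ 2 ^ x.length := by
  have h : x ∈ WF d ↔ ((fstF x = fanoutFn (fstF ∘ fstF) (sndF ∘ fstF) x ∧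
      (fstF ∘ fstF) x = (fun _ => unaryEncodeNat d) x) ∧ (sndF ∘ fstF) x ∈ ListCode d) ∧
      fanoutFn id (subFn ∘ fanoutFn (prodF d ∘ sndF ∘ fstF) (fun _ => [true])) x ∈ LenLe X := Iff.rfl
  rw [h]
  simp only [Function.comp_apply, fanoutFn_apply, boolPair_mem_LenLe, eval_X, subFn_boolPair,
    mem_ListCode_iff, id, bitsToNat_cons, bitsToNat_nil, Bool.toNat_true, mul_zero, add_zero]
  have hpow := Nat.one_le_two_pow (n := x.length)
  constructor
  · rintro ⟨⟨⟨hwp, hhdr⟩, ws, hlen, hws⟩, hprod⟩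
    subst hlen
    refine ⟨ws, rfl, ?_, ?_⟩
    · show fstF x = _
      rw [hwp, hhdr, hws, encode_eq]
    · rw [hws, prodF_listcode, bitsToNat_encodeNat, TM2Pass.length_encodeNat_eq_size, Nat.size_le] at hprod
      omega
  · rintro ⟨ws, hlen, hcode, hprod⟩
    subst hlen
    have hfst : fstF x = boolPair (unaryEncodeNat ws.length) (listcode ws) := hcode
    have h1 : fstF (fstF x) = unaryEncodeNat ws.length := by rw [hfst, fstF_boolPair]
    have h2 : sndF (fstF x) = listcode ws := by rw [hfst, sndF_boolPair]
    refine ⟨⟨⟨by rw [h1, h2, hfst], h1⟩, ws, rfl, h2⟩, ?_⟩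
    rw [h2, prodF_listcode, bitsToNat_encodeNat, TM2Pass.length_encodeNat_eq_size, Nat.size_le]
    omega

/-! ### Assembly -/

/-- **The Sipser language as a `P`-guarded quantifier language**:
`sipserLang d A = WF d ∩ startF ⁻¹' quantLang A d (bodd d)`. [cite: Ko1989, §4.2 (p. 15–16)] -/
theorem sipserLang_eq (d : ℕ) (A : Language Bool) :
    sipserLang d A = WF d ⊓ startF ⁻¹' quantLang A d (Nat.bodd d) := by
  ext x
  have memI : x ∈ WF d ⊓ startF ⁻¹' quantLang A d (Nat.bodd d) ↔
      x ∈ WF d ∧ startF x ∈ quantLang A d (Nat.bodd d) := Iff.rfl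
  rw [memI, mem_WF_iff, startF_apply]
  have h2 : ∀ ws : List ℕ, (boolUnpair x).1 = encodingListNatBool.encode ws →
      sndF (fstF x) = listcode ws := fun ws hcode => by
    rw [show fstF x = (boolUnpair x).1 from rfl, hcode, encode_eq, sndF_boolPair]
  have hfun : ∀ ws : List ℕ, (fun a : Addr ws => leafBit A x (0 + 1 * addrIndex ws a)) =
      fun a => A.boolIndicator (sipserAddr x (addrIndex ws a)) := fun ws => by
    funext a
    rw [zero_add, one_mul, leafBit_eq]
  constructor
  · rintro ⟨ws, hlen, hcode, hprod, hval⟩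
    refine ⟨⟨ws, hlen, hcode, hprod⟩, ?_⟩
    subst hlen
    rw [h2 ws hcode, mem_quantLang_iff, hfun]
    exact hval
  · rintro ⟨⟨ws, hlen, hcode, hprod⟩, hq⟩
    subst hlen
    rw [h2 ws hcode, mem_quantLang_iff, hfun] at hq
    exact ⟨ws, rfl, hcode, hprod, hq⟩

end SipserPH

/-- **Discharge of `sipserLang_mem_PHRel`: the Sipser languages are in `PH^A`.** For every `d` and
every oracle `A`, `sipserLang d A ∈ PH^A`: a `P` test of well-formedness, then `d` alternating
polynomially bounded quantifiers over child indices folded into an offset/weight record, over one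
oracle query ("Then, clearly, `L_A ∈ Σₖ^P(A)`"). [cite: Ko1989, §4.2 (p. 15–16)] -/
theorem sipserLang_mem_PHRel_holds : sipserLang_mem_PHRel := by
  intro d A
  rw [SipserPH.sipserLang_eq]
  exact inter_P_mem_PHRel (SipserPH.WF_mem_P d)
    (preimage_mem_PHRel (SipserPH.quantLang_mem_PHRel A d _) SipserPH.startF_mem_FP)

end Literature.Computability.Complexity

end
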